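import Summits.ABC.IUTFork.Cor312Ind3RealIterates
import Summits.ABC.IUTFork.Thm311Real3
import Summits.ABC.IUTFork.Thm311RealLog
import HarnessLib

/-!
# [IUTchIII] Theorem 3.11 (ii) at the REAL carriers: the typed (ii) for the strictified real lattice
# situation with the honest log-link iterate images, unconditional in the logarithm, images NONEMPTY

Proof-only file (D-0012; abc-iut cell, D-0067 discharge wave 4, seat abc-iut-w4-d087; CONE-BOARD node
`IUTchIII:Thm3.11(ii)` = abc-iut-c312-1's NAMED PIECE «Thm3.11(ii)-strict», part 2 of 2 — part 1 is the generic
`Thm311PartIIDischarge.lean`; this is the real-carrier sequel announced there, SUPERSEDING the module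
`Thm311PartIIDischargeReal.lean` (p412451, operator retirement requested: its definitions duplicate
abc-iut-w4-d029's earlier `Cor312Ind3RealIterates.lean`)); TAKES NO SIDE on
[IUTchIII] Cor. 3.12. S. Mochizuki, *Inter-universal Teichmüller theory III*, kurims manuscript (May 2020):
Thm. 3.11 (ii) and (Ind3) pp. 155–156, Prop. 3.5 (ii) (a), (b) pp. 104–105, Rmk. 1.1.1 (i) p. 28, Rmk. 1.2.2
(i)–(iii) pp. 36–37. [claim: Mochizuki2012, status: disputed]

INPUTS (all landed, consumed by name; no definition here). abc-iut-c312-5's real carriers `K_v`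
(`Thm311Real.lean`: `Carrier`, `shell logv`, `Real.logShells X logv Aut Ism …`, the law `Real.LogvLaw`, the
analytic logarithms `Real.analyticLogv` with `logvLaw_analyticLogv`), abc-iut-c312-12's pure-tensor images and
honest unit sets (`Cor312Ind3Real.lean`: `LogShells.tprodImages`, `Column.ind3_of_componentwise`,
`Real.unitsSet`), and abc-iut-w4-d029's HONEST LOG-LINK ITERATE IMAGES (`Cor312Ind3RealIterates.lean`:
`Real.iterImage logv m' x` — at a finite place the image of the `m'`-th iterate of `log_v` on `O_v^×`, at an
archimedean place the `m'`-th iterate of the principal logarithm on `{‖a‖ = 1}` read through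
`extensionEmbedding`; `iterImage_zero`, `iterImage_subset_shell_of_one_le` = upper semi-commutativity for
EVERY logarithm binder), whose closing theorems are stated for the Dupuy–Hilado instance `logShellsDH` at the
column level. THIS FILE adds:

* §1 `Column.ind3_logShells_of_honestImages` — (Ind3) for every column over the GENERAL instance
  `Real.logShells X logv Aut Ism …` (ANY automorphism binders `Aut`, `Ism` — the residual mono-analytic content
  of c312-5's instance; `logShellsDH` is the special case) whose unit-group images are the pure-tensor images
  of `Real.iterImage` and whose radius-`π` balls are those of the shells, under the law and
  `L.shellPk ⊆ D.shellPk`; no iterate hypothesis at any place.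
* §2 `Real.partII_ofShells_honestImages` — **the typed Thm. 3.11 (ii) (`LatticeSituation.PartII`) HOLDS** for
  "the situation of Theorem 3.11" BUILT over the real carriers (c312-5's `LatticeSituation.ofShells`,
  strictified reading: each column's Frobenius-like binders := the coric data of its line, Kummer = identity —
  c312-5's vacuity audit `partII_iff_ind3_of_coric`) with these images, given the law and `L.shellPk ⊆ archPk`
  at archimedean `v_ℚ`; `Real.partII_ofShells_honestImages_analyticLogv` — UNCONDITIONAL IN THE LOGARITHM at
  `logv := Real.analyticLogv F`; `Real.partII_ofShells_defined` — with the archimedean integral structure :=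
  the pure tensors of shell elements `L.shellPk` (c312-5: "makes sense at every `v_ℚ`") NO residual
  hypothesis at all: the binders left free (`Aut`, `Ism`, `archSub`, `Adm`, `logvol`, `Ψ`, `act`, `Mmod`,
  `region`, `thetaDiv`) are exactly the ones (ii) does not constrain in this reading.
* §3 NON-EMPTINESS (audit observation OBS-1 of abc-iut-w4-d044 on part 1: the generic discharge is satisfiable
  by EMPTY unit data; the honesty of the images rides on the instance): `Real.one_mem_unitsSet` (`1 ∈ O_v^×` at
  every place), `LogShells.tprodImages_nonempty`, `Real.tprodImages_iterImage_zero_nonempty` (the un-iterated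
  images `⊗ (u_{i,v})` are inhabited at every `v_ℚ`), `Real.tprod_units_mem_tprodImages_iterImage_zero` (every
  pure tensor of local units IS in the `m' = 0` image — Prop. 3.5 (ii) (a) (1) is carried),
  `Real.nonarchIterImage_one_nonempty` / `Real.tprodImages_iterImage_one_nonempty_of_isNon` (at `V^non` the
  FIRST-ITERATE images `⊗ (log_v u_{i,v})` are inhabited: the first iterate is defined on all of `O_v^×`).

HONEST FRAMING (verbatim from the typer's hand-off): this discharges the TYPED (ii) in the STRICTIFIED reading
(Kummer = identity on the coric carriers, `KummerA/B/C` by `rfl`); the content of (ii) beyond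
(Ind3)-as-containment is not captured by the typing. History: `Thm311PartIIDischargeReal.lean` (p412451)
defined its own iterates (`Real.logStep/logIter/iterImage/iterUnits`); those were yielded to abc-iut-w4-d029's
p412330 (same content, filed first; FQN clash F-w5d064-1 on `Real.iterImage`) — this file is proof-only over
d029's names and nothing here or downstream should import `Thm311PartIIDischargeReal`. typed ≠ endorsed.
-/

noncomputable section

open Set

namespace Summit.ABC.IUTFork.Thm311

/-! ## §1 (Ind3) over the general real instance, no iterate hypothesis -/

namespace Column

open Real NumberField IsDedekindDomain Literature.IUT.LogVolume Literature.IUT.LogThetaLattice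

variable {F : Type} [Field F] [NumberField F]

/-- **[IUTchIII] Thm. 3.11 (ii) (Ind3) AT THE REAL CARRIERS, every iterate clause DISCHARGED** (p. 156 ←
Prop. 3.5 (ii) (a), (b) pp. 104–105): for every column over abc-iut-c312-5's `Real.logShells X logv Aut Ism …`
(any automorphism binders) whose transported unit-group images at `(m, m')` are the pure-tensor images of
abc-iut-w4-d029's honest per-place iterate images `Real.iterImage logv m'` and whose radius-`π` balls are the
pure-tensor images of the shells, (Ind3) HOLDS under the law `O_v ⊆ I_v` and `L.shellPk ⊆ D.shellPk` — the
un-iterated containments by abc-iut-c312-12's `unitsSet_subset_shell`, the iterate containments by d029's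
`iterImage_subset_shell_of_one_le` (upper semi-commutativity, any `logv`). [claim: Mochizuki2012, status: disputed] -/
theorem ind3_logShells_of_honestImages (X : PilotData F) (logv : PadicLogs F) (hlaw : LogvLaw logv)
    (Aut Ism : ∀ x : Place F, Set (Carrier x ≃ₗ[ℚ] Carrier x))
    (hAut : ∀ x, LinearEquiv.refl ℚ (Carrier x) ∈ Aut x) (hIsm : ∀ x, LinearEquiv.refl ℚ (Carrier x) ∈ Ism x)
    (C : Column (logShells X logv Aut Ism hAut hIsm)) (D : MRData (logShells X logv Aut Ism hAut hIsm))
    (hpk : ∀ (j : (thetaIndex X).Label) (vQ : (thetaIndex X).VQ),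
      ((logShells X logv Aut Ism hAut hIsm).shellPk j vQ :
        Set ((logShells X logv Aut Ism hAut hIsm).Packet j vQ)) ⊆ D.shellPk j vQ)
    (hunit : ∀ (m : ℤ) (m' : ℕ) (j : (thetaIndex X).Label) (vQ : (thetaIndex X).VQ),
      C.unitImage m m' j vQ =
        (logShells X logv Aut Ism hAut hIsm).tprodImages j vQ fun v => iterImage logv m' v.1)
    (hball : ∀ (m : ℤ) (j : (thetaIndex X).Label) (vQ : (thetaIndex X).VQ),
      C.ballImage m j vQ =
        (logShells X logv Aut Ism hAut hIsm).tprodImages j vQ fun v => shell logv v.1) :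
    C.Ind3 D := by
  have hshell : ∀ (vQ : (thetaIndex X).VQ) (v : (thetaIndex X).Fibre vQ),
      (shell logv v.1 : Set ((logShells X logv Aut Ism hAut hIsm).carrier v.1)) ⊆
        ((logShells X logv Aut Ism hAut hIsm).shellSubgroup v.1 :
          Set ((logShells X logv Aut Ism hAut hIsm).carrier v.1)) :=
    fun vQ v => (logShells X logv Aut Ism hAut hIsm).shell_subset_shellSubgroup v.1
  have h0 : ∀ (vQ : (thetaIndex X).VQ) (v : (thetaIndex X).Fibre vQ),
      (iterImage logv 0 v.1 : Set ((logShells X logv Aut Ism hAut hIsm).carrier v.1)) ⊆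
        ((logShells X logv Aut Ism hAut hIsm).shellSubgroup v.1 :
          Set ((logShells X logv Aut Ism hAut hIsm).carrier v.1)) := fun vQ v => by
    rw [iterImage_zero logv v.1]
    exact (unitsSet_subset_shell hlaw v.1).trans (hshell vQ v)
  refine C.ind3_of_componentwise D hpk (fun _ m' vQ v => iterImage logv m' v.1)
    (fun _ vQ v => shell logv v.1) ?_ ?_ ?_ ?_ hunit hball
  · intro m m' vQ _ v
    rcases Nat.eq_zero_or_pos m' with rfl | hm'
    · exact h0 vQ v
    · exact (iterImage_subset_shell_of_one_le logv hm' v.1).trans (hshell vQ v)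
  · exact fun m vQ _ v => h0 vQ v
  · exact fun m vQ _ v => hshell vQ v
  · exact fun m m' hm' vQ _ v => iterImage_subset_shell_of_one_le logv hm' v.1

end Column

/-! ## §2 The typed Thm. 3.11 (ii) for the strictified lattice situation over the real carriers -/

namespace Real

open NumberField IsDedekindDomain Literature.IUT.LogVolume Literature.IUT.LogThetaLattice

variable {F : Type} [Field F] [NumberField F]
variable (X : PilotData F) (logv : PadicLogs F) (Aut Ism : ∀ x : Place F, Set (Carrier x ≃ₗ[ℚ] Carrier x))
  (hAut : ∀ x, LinearEquiv.refl ℚ (Carrier x) ∈ Aut x) (hIsm : ∀ x, LinearEquiv.refl ℚ (Carrier x) ∈ Ism x)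
  (archPk : ∀ (j : (thetaIndex X).Label) (vQ : (thetaIndex X).VQ),
    Set ((logShells X logv Aut Ism hAut hIsm).Packet j vQ))
  (archSub : ∀ (j : (thetaIndex X).Label) (v : Place F),
    Set ((logShells X logv Aut Ism hAut hIsm).Packet j ((thetaIndex X).over v)))
  (Adm : ∀ (j : (thetaIndex X).Label) (vQ : (thetaIndex X).VQ),
    Set ((logShells X logv Aut Ism hAut hIsm).Packet j vQ) → Prop)
  (logvol : ∀ (j : (thetaIndex X).Label) (vQ : (thetaIndex X).VQ),
    Set ((logShells X logv Aut Ism hAut hIsm).Packet j vQ) → ℝ)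
  (Ψ : ℤ → ∀ v : Place F, v ∈ (thetaIndex X).Vbad → Set ((logShells X logv Aut Ism hAut hIsm).StarPacket v))
  (act : ℤ → ∀ v : Place F, v ∈ (thetaIndex X).Vbad → (logShells X logv Aut Ism hAut hIsm).StarPacket v →
    Module.End ℚ ((logShells X logv Aut Ism hAut hIsm).StarPacket v))
  (Mmod : ℤ → ∀ j : (thetaIndex X).LabelStar, Set ((logShells X logv Aut Ism hAut hIsm).GlobalPacket j.1))
  (region : ℤ → ∀ j : (thetaIndex X).LabelStar,
    FinDivisor F → ∀ vQ : (thetaIndex X).VQ, Set ((logShells X logv Aut Ism hAut hIsm).Packet j.1 vQ))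
  (thetaDiv₀ : ℤ → ℤ → LgpDivisor F (thetaIndex X).lstar)

/-- **[IUTchIII] Thm. 3.11 (ii) — the TYPED (ii) (`LatticeSituation.PartII`) HOLDS for "the situation of
Theorem 3.11" OVER THE REAL CARRIERS in the strictified reading** (abc-iut-c312-5's
`LatticeSituation.ofShells` over `Real.logShells X logv Aut Ism …`; each column's Frobenius-like binders := the
coric data of its line; unit-group images := pure tensors of abc-iut-w4-d029's honest iterate images
`Real.iterImage logv m'`; radius-`π` balls := pure tensors of the shells), given the law `O_v ⊆ I_v` on the
logarithm binder and the archimedean integral-structure binder `archPk` containing the pure tensors of shell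
elements. Route: c312-5's `LatticeSituation.partII_iff_ind3_of_coric` and `Column.ind3_logShells_of_honestImages`.
HONEST FRAMING: module docstring. [claim: Mochizuki2012, status: disputed] -/
theorem partII_ofShells_honestImages (hlaw : LogvLaw logv)
    (harch : ∀ (j : (thetaIndex X).Label) (vQ : (thetaIndex X).VQ), ¬ (thetaIndex X).IsNon vQ →
      ((logShells X logv Aut Ism hAut hIsm).shellPk j vQ :
        Set ((logShells X logv Aut Ism hAut hIsm).Packet j vQ)) ⊆ archPk j vQ) :
    (LatticeSituation.ofShells (logShells X logv Aut Ism hAut hIsm) F archPk archSub Adm logvol Ψ act Mmod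
        region (fun _ _ => Adm) (fun _ _ => logvol) (fun n _ => Ψ n) (fun n _ => Mmod n)
        (fun _ _ m' j vQ => (logShells X logv Aut Ism hAut hIsm).tprodImages j vQ fun v => iterImage logv m' v.1)
        (fun _ _ j vQ => (logShells X logv Aut Ism hAut hIsm).tprodImages j vQ fun v => shell logv v.1)
        thetaDiv₀).PartII := by
  refine (LatticeSituation.partII_iff_ind3_of_coric (logShells X logv Aut Ism hAut hIsm) F archPk archSub Adm
    logvol Ψ act Mmod region _ _ thetaDiv₀).mpr fun n => ?_
  refine Column.ind3_logShells_of_honestImages X logv hlaw Aut Ism hAut hIsm _ _ (fun j vQ => ?_)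
    (fun _ _ _ _ => rfl) (fun _ _ _ => rfl)
  show ((logShells X logv Aut Ism hAut hIsm).shellPk j vQ : Set _) ⊆
    (MRData.ofShells (logShells X logv Aut Ism hAut hIsm) archPk archSub Adm logvol (Ψ n) (act n)
      (Mmod n)).shellPk j vQ
  by_cases hv : (thetaIndex X).IsNon vQ
  · rw [MRData.ofShells_shellPk_of_isNon _ archPk archSub Adm logvol (Ψ n) (act n) (Mmod n) hv]
  · rw [MRData.ofShells_shellPk_of_not_isNon _ archPk archSub Adm logvol (Ψ n) (act n) (Mmod n) hv]
    exact harch j vQ hv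

end Real

namespace Real

open NumberField IsDedekindDomain Literature.IUT.LogVolume Literature.IUT.LogThetaLattice

variable {F : Type} [Field F] [NumberField F]
variable (X : PilotData F) (Aut Ism : ∀ x : Place F, Set (Carrier x ≃ₗ[ℚ] Carrier x))
  (hAut : ∀ x, LinearEquiv.refl ℚ (Carrier x) ∈ Aut x) (hIsm : ∀ x, LinearEquiv.refl ℚ (Carrier x) ∈ Ism x)
  (archPk : ∀ (j : (thetaIndex X).Label) (vQ : (thetaIndex X).VQ),
    Set ((logShells X (analyticLogv F) Aut Ism hAut hIsm).Packet j vQ))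
  (archSub : ∀ (j : (thetaIndex X).Label) (v : Place F),
    Set ((logShells X (analyticLogv F) Aut Ism hAut hIsm).Packet j ((thetaIndex X).over v)))
  (Adm : ∀ (j : (thetaIndex X).Label) (vQ : (thetaIndex X).VQ),
    Set ((logShells X (analyticLogv F) Aut Ism hAut hIsm).Packet j vQ) → Prop)
  (logvol : ∀ (j : (thetaIndex X).Label) (vQ : (thetaIndex X).VQ),
    Set ((logShells X (analyticLogv F) Aut Ism hAut hIsm).Packet j vQ) → ℝ)
  (Ψ : ℤ → ∀ v : Place F, v ∈ (thetaIndex X).Vbad →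
    Set ((logShells X (analyticLogv F) Aut Ism hAut hIsm).StarPacket v))
  (act : ℤ → ∀ v : Place F, v ∈ (thetaIndex X).Vbad →
    (logShells X (analyticLogv F) Aut Ism hAut hIsm).StarPacket v →
      Module.End ℚ ((logShells X (analyticLogv F) Aut Ism hAut hIsm).StarPacket v))
  (Mmod : ℤ → ∀ j : (thetaIndex X).LabelStar,
    Set ((logShells X (analyticLogv F) Aut Ism hAut hIsm).GlobalPacket j.1))
  (region : ℤ → ∀ j : (thetaIndex X).LabelStar, FinDivisor F → ∀ vQ : (thetaIndex X).VQ,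
    Set ((logShells X (analyticLogv F) Aut Ism hAut hIsm).Packet j.1 vQ))
  (thetaDiv₀ : ℤ → ℤ → LgpDivisor F (thetaIndex X).lstar)

/-- **Thm. 3.11 (ii) for the strictified real lattice situation, UNCONDITIONAL IN THE LOGARITHM**: at the
ANALYTIC `p_v`-adic logarithms `logv := Real.analyticLogv F` (abc-iut-S1's `unitLog` in abc-iut-S7's rescaled
completions; the law `O_v ⊆ I_v` is abc-iut-c312-5's `logvLaw_analyticLogv`), `LatticeSituation.PartII` holds
given only `L.shellPk ⊆ archPk` at archimedean `v_ℚ`. [claim: Mochizuki2012, status: disputed] -/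
theorem partII_ofShells_honestImages_analyticLogv
    (harch : ∀ (j : (thetaIndex X).Label) (vQ : (thetaIndex X).VQ), ¬ (thetaIndex X).IsNon vQ →
      ((logShells X (analyticLogv F) Aut Ism hAut hIsm).shellPk j vQ :
        Set ((logShells X (analyticLogv F) Aut Ism hAut hIsm).Packet j vQ)) ⊆ archPk j vQ) :
    (LatticeSituation.ofShells (logShells X (analyticLogv F) Aut Ism hAut hIsm) F archPk archSub Adm logvol Ψ
        act Mmod region (fun _ _ => Adm) (fun _ _ => logvol) (fun n _ => Ψ n) (fun n _ => Mmod n)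
        (fun _ _ m' j vQ =>
          (logShells X (analyticLogv F) Aut Ism hAut hIsm).tprodImages j vQ fun v =>
            iterImage (analyticLogv F) m' v.1)
        (fun _ _ j vQ =>
          (logShells X (analyticLogv F) Aut Ism hAut hIsm).tprodImages j vQ fun v =>
            shell (analyticLogv F) v.1)
        thetaDiv₀).PartII :=
  partII_ofShells_honestImages X (analyticLogv F) Aut Ism hAut hIsm archPk archSub Adm logvol Ψ act Mmod region
    thetaDiv₀ (logvLaw_analyticLogv F) harch

/-- **[IUTchIII] Thm. 3.11 (ii) — the TYPED (ii) HOLDS WITH NO RESIDUAL HYPOTHESIS** for "the situation of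
Theorem 3.11" over abc-iut-c312-5's real carriers in the strictified reading, at the analytic logarithms, with
the unit-group images := pure tensors of the honest iterate images, the radius-`π` balls := pure tensors of the
shells, and the archimedean integral structure := the pure tensors of shell elements `L.shellPk` (c312-5: "makes
sense at every `v_ℚ`"). The binders left free (`Aut`, `Ism`, `archSub`, `Adm`, `logvol`, `Ψ`, `act`, `Mmod`,
`region`, `thetaDiv`) are the ones (ii) does not constrain in this reading (c312-5's vacuity audit).
HONEST FRAMING: module docstring. [claim: Mochizuki2012, status: disputed] -/
theorem partII_ofShells_defined :
    (LatticeSituation.ofShells (logShells X (analyticLogv F) Aut Ism hAut hIsm) F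
        (fun j vQ => ((logShells X (analyticLogv F) Aut Ism hAut hIsm).shellPk j vQ :
          Set ((logShells X (analyticLogv F) Aut Ism hAut hIsm).Packet j vQ)))
        archSub Adm logvol Ψ act Mmod region (fun _ _ => Adm) (fun _ _ => logvol) (fun n _ => Ψ n)
        (fun n _ => Mmod n)
        (fun _ _ m' j vQ =>
          (logShells X (analyticLogv F) Aut Ism hAut hIsm).tprodImages j vQ fun v =>
            iterImage (analyticLogv F) m' v.1)
        (fun _ _ j vQ =>
          (logShells X (analyticLogv F) Aut Ism hAut hIsm).tprodImages j vQ fun v =>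
            shell (analyticLogv F) v.1)
        thetaDiv₀).PartII :=
  partII_ofShells_honestImages_analyticLogv X Aut Ism hAut hIsm _ archSub Adm logvol Ψ act Mmod region thetaDiv₀
    fun _ _ _ => subset_rfl

end Real

/-! ## §3 Non-emptiness of the (Ind3) unit-group images of the real columns -/

namespace LogShells

variable {T : ThetaIndex} (L : LogShells T)

/-- A pure-tensor image set is inhabited as soon as every component set is. [folklore] -/
theorem tprodImages_nonempty {j : T.Label} {vQ : T.VQ} {S : ∀ v : T.Fibre vQ, Set (L.carrier v.1)}
    (h : ∀ v, (S v).Nonempty) : (L.tprodImages j vQ S).Nonempty := by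
  choose x hx using h
  exact ⟨L.tprod j vQ fun _ v => x v, fun _ v => x v, fun _ v => hx v, rfl⟩

/-- Every pure tensor with components in the component sets lies in the image set. [folklore] -/
theorem tprod_mem_tprodImages {j : T.Label} {vQ : T.VQ} {S : ∀ v : T.Fibre vQ, Set (L.carrier v.1)}
    (x : T.Caps j → L.Packet1 vQ) (hx : ∀ i (v : T.Fibre vQ), x i v ∈ S v) :
    L.tprod j vQ x ∈ L.tprodImages j vQ S :=
  ⟨x, hx, rfl⟩

end LogShells

namespace Real

open NumberField IsDedekindDomain Literature.IUT.LogVolume Literature.IUT.LogThetaLattice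

variable {F : Type} [Field F] [NumberField F]

/-- `1 ∈ O_v^×` at every place (finite: `1` is a unit of the valuation ring; archimedean: `‖1‖ = 1`) — the
honest unit sets are inhabited. [folklore] -/
theorem one_mem_unitsSet : ∀ x : Place F, (1 : Carrier x) ∈ unitsSet x
  | .inl w => by
    show ‖(1 : Carrier (.inl w : Place F))‖ = 1
    exact norm_one
  | .inr v => by
    refine ⟨one_ne_zero, (integers v).one_mem, ?_⟩
    rw [inv_one]
    exact (integers v).one_mem

/-- The honest unit sets are nonempty at every place. [folklore] -/
theorem unitsSet_nonempty (x : Place F) : (unitsSet x).Nonempty := ⟨1, one_mem_unitsSet x⟩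

/-- At a finite place the image of the FIRST iterate of the log-link on the units is inhabited — it contains
`log_v 1` (the first iterate is defined on all of `O_v^×`, [IUTchIII] Rmk. 1.1.1 (i)).
[claim: Mochizuki2012, status: disputed] -/
theorem nonarchIterImage_one_nonempty (logv : PadicLogs F) (v : HeightOneSpectrum (𝓞 F)) :
    (nonarchIterImage logv v 1).Nonempty := by
  refine ⟨logv v (Additive.ofMul 1), (1 : (↥(integers (F := F) v))ˣ), ?_, rfl⟩
  show (((1 : (↥(integers (F := F) v))ˣ) : ↥(integers (F := F) v)) : Carrier (.inr v : Place F)) ∈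
    nonarchIterImage logv v 0
  rw [nonarchIterImage_zero, Units.val_one, OneMemClass.coe_one]
  exact one_mem_unitsSet (.inr v)

variable (X : PilotData F) (logv : PadicLogs F) (Aut Ism : ∀ x : Place F, Set (Carrier x ≃ₗ[ℚ] Carrier x))
  (hAut : ∀ x, LinearEquiv.refl ℚ (Carrier x) ∈ Aut x) (hIsm : ∀ x, LinearEquiv.refl ℚ (Carrier x) ∈ Ism x)

/-- **NON-EMPTINESS of the un-iterated (Ind3) unit-group images of the real columns** ([IUTchIII] Prop. 3.5
(ii) (a) (1) / (b) (1)): at every `(j, v_ℚ)` the pure-tensor image of the `m' = 0` components (`= O_v^×` at every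
place, d029's `iterImage_zero`) is inhabited — e.g. by `⊗_{i,v} 1`. [claim: Mochizuki2012, status: disputed] -/
theorem tprodImages_iterImage_zero_nonempty (j : (thetaIndex X).Label) (vQ : (thetaIndex X).VQ) :
    ((logShells X logv Aut Ism hAut hIsm).tprodImages j vQ fun v => iterImage logv 0 v.1).Nonempty :=
  (logShells X logv Aut Ism hAut hIsm).tprodImages_nonempty fun v => by
    rw [iterImage_zero logv v.1]
    exact unitsSet_nonempty v.1

/-- Every pure tensor `⊗_{i ∈ S^±_{j+1}} (u_{i,v})_{v | v_ℚ}` of local UNITS lies in the `m' = 0` image of the real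
columns — the image "of the groups of units … via the tensor product, over such `|t|`, of the [relevant] Kummer
isomorphisms" (Prop. 3.5 (ii) (a) (1)) IS carried, not a schema satisfiable by `∅`.
[claim: Mochizuki2012, status: disputed] -/
theorem tprod_units_mem_tprodImages_iterImage_zero (j : (thetaIndex X).Label) (vQ : (thetaIndex X).VQ)
    (x : (thetaIndex X).Caps j → (logShells X logv Aut Ism hAut hIsm).Packet1 vQ)
    (hx : ∀ i (v : (thetaIndex X).Fibre vQ), x i v ∈ unitsSet v.1) :
    (logShells X logv Aut Ism hAut hIsm).tprod j vQ x ∈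
      (logShells X logv Aut Ism hAut hIsm).tprodImages j vQ fun v => iterImage logv 0 v.1 :=
  (logShells X logv Aut Ism hAut hIsm).tprod_mem_tprodImages x fun i v => by
    rw [iterImage_zero logv v.1]
    exact hx i v

/-- **NON-EMPTINESS of the FIRST-ITERATE (Ind3) images at nonarchimedean `v_ℚ`** ([IUTchIII] Prop. 3.5 (ii)
(a) (2), `m' = 1`): every place over a prime is finite, and there the first iterate of the log-link is defined
on all of `O_v^×`, so the pure-tensor image `⊗_{i,v} (log_v u_{i,v})` is inhabited.
[claim: Mochizuki2012, status: disputed] -/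
theorem tprodImages_iterImage_one_nonempty_of_isNon (j : (thetaIndex X).Label) (vQ : (thetaIndex X).VQ)
    (hv : (thetaIndex X).IsNon vQ) :
    ((logShells X logv Aut Ism hAut hIsm).tprodImages j vQ fun v => iterImage logv 1 v.1).Nonempty := by
  refine (logShells X logv Aut Ism hAut hIsm).tprodImages_nonempty fun v => ?_
  obtain ⟨y, hy⟩ := v
  rcases y with w | w
  · -- an archimedean place does not lie over a prime
    exfalso
    change Place.under (.inl w : Place F) = vQ at hy
    rw [Place.under_inl] at hy
    subst hy
    exact hv
  · exact nonarchIterImage_one_nonempty logv w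

end Real

end Summit.ABC.IUTFork.Thm311

end
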